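import Literature.Topology.FourManifolds.TrisectionsCornerHadamardSector
import Literature.Topology.FourManifolds.TrisectionsAmbientMorseLemmas
import Literature.Topology.FourManifolds.TrisectionsSectorMorse
import HarnessLib

/-!
# The re-structured sector of a Gay–Kirby trisection carries its handle decomposition
# (normal form with an ambient Morse function)

Topic `Literature/Topology/FourManifolds`; infrastructure for the fact seat
`provefact-Literature.Topology.FourManifolds.exists-14560f9fc8` (named fact (c′)
`Literature.Topology.FourManifolds.exists_stabilized_gkTrisection`), completing the programme
of `TrisectionsNormalCoordinates.lean`, `TrisectionsProductStructure.lean`,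
`TrisectionsSectorRestructure.lean`, `TrisectionsMorseTransport.lean`,
`TrisectionsCornerHadamard*.lean` and `TrisectionsAmbientMorseLemmas.lean`.  Everything in
this file is **proved**; no definitions, no named facts.

**Theorems (`hasHandleDecomposition_of_normalForm` — input form, for use in the stabilisation
surgery — and `IsGKTrisection.exists_cornerSliceAtlas_hasHandleDecomposition`).**  *Let `S` be a
trisection with corners of a closed smooth `4`-manifold `X`
(`Literature.Topology.FourManifolds.IsGKTrisection X g k S`), `S i` a sector and `S j` a second
sector.  There are global normal coordinates `u, v`, an open `U` in which the three sectors are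
the three linear sectors of the `(u, v)`-plane and the central surface is `F = {u = v = 0}`, a
smooth retraction `ρ` of a neighbourhood `O` of `F` onto `F`, and a corner-slice atlas `Φ` of
`S i` relative to `(F, u, v, ρ)` such that the subset `S i` with the straightened structure
`Φ.chartedSpace` has a handle decomposition with the handle counts `handleCount 1 (k i)` of
clause (ii).*  Together with `CornerSliceAtlas.sector_smooth_clause` this presents the sector
by *ambient* data which are products near `F` — the normal form in which Gay–Kirby's
stabilisation (Def. 8) is performed.

**Proof.**  The handle decomposition is presented by an ambient function
(`CornerSliceAtlas.hasHandleDecomposition_of_comp_val`)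
`G = 1 - (1 - χ)(1 - F_ext) - χ · 2uv · K ∘ ρ`, where `F_ext` extends the Morse function `f`
of the old sector manifold `e : W → X` off a neighbourhood of `F`
(`exists_contMDiff_extension_off`), `K` is the cornered Hadamard quotient
`1 - f ∘ e⁻¹ = 2uv · K` (`exists_cornerHadamard_global`), and `χ` is the cutoff
`χ₁((u² + v²)/η)` localised near `F` (`exists_localised_cutoff'`).  On `S i` near `F`,
`G = 1 - 2uv[(1 - χ) K + χ K ∘ ρ]`: it is `1` exactly on the faces, `< 1` inside, of corner
form `1 - x₀ · K(Θ⁻¹(stratumProj x))` on shrunk corner charts, regular at the face points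
(one-sided line derivative, `fderiv_ne_zero_of_eventuallyEq_line`) and without critical points
where `u² + v² ≤ η` for `η` small (`hasDerivAt_interp_line_neg`, with constants uniform over a
finite cover of `F`, `exists_uniform_chart_constants`); elsewhere `G ∘ e = f` near every
point, so the critical points of `G` interior to `S i` are the images of those of `f`, with
the same nondegeneracy and indices (`morseData_of_comp_eventuallyEq`); the critical set of `f`
is closed, hence stays away from `F`.

## References

* D. Gay, R. Kirby, *Trisecting 4-manifolds*, Geom. Topol. 20 (2016) 3097–3132, Def. 1 and
  Def. 8. [GayKirby2016]
* J. Milnor, *Morse theory*, Ann. of Math. Studies 51 (1963), §§2–3. [Milnor1963]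
* J. Milnor, *Lectures on the h-cobordism theorem* (1965), Def. 3.1 and §3. [MilnorHCobordism1965]
-/

open scoped Manifold ContDiff Topology
open Set Function Filter

noncomputable section

namespace Literature.Topology.FourManifolds

universe u

section CutoffFrontier

variable {X : Type u} [TopologicalSpace X] [T2Space X] [CompactSpace X]
  [ChartedSpace (EuclideanSpace ℝ (Fin 4)) X] [IsManifold (𝓡 4) ∞ X]

/-- **The cutoff localised at the central surface, with the lower bound on `u² + v²` at the
frontier of `V₁`** (variant of `exists_localised_cutoff` recording that `u² + v² > η₀` on
`closure V₁ ∖ V₁`, so that the cutoff vanishes identically near those points).  Let `F ⊆ V`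
(`F` closed, `V` open) and
`u, v` smooth functions whose common zeros inside `V` lie in `F`.  There are an open `V₁` with
`F ⊆ V₁ ⊆ V` and `η₀ > 0` such that for every `0 < η ≤ η₀` the function
`χ = χ₁((u² + v²)/η)` on `V₁`, extended by `0`, is smooth on `X` (it is `β · χ₁((u² + v²)/η)`
for a smooth `β` equal to `1` near `V̄₁` and supported in `V`; on the support of `β` outside
`V₁`, `u² + v² ≥ 2η₀ > η`, where `χ₁ = 0`).  Here `χ₁ x = smoothTransition (2 - 2x)`.
[folklore] -/
theorem exists_localised_cutoff' {F V : Set X} (hF : IsClosed F) (hV : IsOpen V) (hFV : F ⊆ V)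
    {u v : X → ℝ} (hu : ContMDiff (𝓡 4) 𝓘(ℝ, ℝ) ∞ u) (hv : ContMDiff (𝓡 4) 𝓘(ℝ, ℝ) ∞ v)
    (hzero : ∀ y ∈ V, u y = 0 → v y = 0 → y ∈ F) :
    ∃ (V₁ : Set X) (η₀ : ℝ), IsOpen V₁ ∧ F ⊆ V₁ ∧ closure V₁ ⊆ V ∧ 0 < η₀ ∧
      (∀ y ∈ closure V₁, y ∉ V₁ → η₀ < u y ^ 2 + v y ^ 2) ∧
      ∀ η : ℝ, 0 < η → η ≤ η₀ → ∃ χ : X → ℝ, ContMDiff (𝓡 4) 𝓘(ℝ, ℝ) ∞ χ ∧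
        (∀ y, 0 ≤ χ y ∧ χ y ≤ 1) ∧
        (∀ y ∈ V₁, χ y = Real.smoothTransition (2 - 2 * ((u y ^ 2 + v y ^ 2) / η))) ∧
        (∀ y ∉ V₁, χ y = 0) := by
  haveI : LocallyCompactSpace X := ChartedSpace.locallyCompactSpace (EuclideanSpace ℝ (Fin 4)) X
  obtain ⟨V₁, hV₁o, hFV₁, hclV₁, hV₁c⟩ :=
    exists_open_between_and_isCompact_closure hF.isCompact hV hFV
  -- an intermediate open set `V'` and a smooth `β` with `β = 1` on `closure V₁`, `β = 0` off `V'`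
  obtain ⟨V', hV'o, hV₁V', hclV', -⟩ := exists_open_between_and_isCompact_closure hV₁c hV hclV₁
  obtain ⟨β, hβ0, hβ1, hβ01⟩ := exists_contMDiffMap_zero_one_of_isClosed (I := 𝓡 4) (n := (⊤ : ℕ∞))
    hV'o.isClosed_compl isClosed_closure (disjoint_compl_left_iff.2 hV₁V')
  -- `u² + v²` is bounded below on the compact `tsupport β ∖ V₁`
  set r2 : X → ℝ := fun y => u y ^ 2 + v y ^ 2 with hr2
  have hr2c : Continuous r2 := (hu.continuous.pow 2).add (hv.continuous.pow 2)
  set K₀ : Set X := tsupport β ∩ V₁ᶜ with hK₀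
  have hK₀c : IsCompact K₀ := (isClosed_tsupport _).isCompact.inter_right hV₁o.isClosed_compl
  have htsupp : tsupport β ⊆ V := by
    have hsupp : Function.support (β : X → ℝ) ⊆ V' := by
      intro y hy
      by_contra hyV'
      exact hy (hβ0 hyV')
    exact (closure_mono hsupp).trans hclV'

  obtain ⟨c₀, hc₀, hc₀le⟩ : ∃ c₀ : ℝ, 0 < c₀ ∧ ∀ y ∈ K₀, c₀ ≤ r2 y := by
    rcases K₀.eq_empty_or_nonempty with hK | hK
    · exact ⟨1, one_pos, fun y hy => by rw [hK] at hy; exact absurd hy (notMem_empty _)⟩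
    · obtain ⟨y₀, hy₀, hmin⟩ := hK₀c.exists_isMinOn hK hr2c.continuousOn
      refine ⟨r2 y₀, ?_, fun y hy => hmin hy⟩
      have hy₀V : y₀ ∈ V := htsupp hy₀.1
      by_contra hle
      have h0 : r2 y₀ = 0 := le_antisymm (not_lt.1 hle) (by positivity)
      have hu0 : u y₀ = 0 := by
        have : u y₀ ^ 2 = 0 := by nlinarith [sq_nonneg (u y₀), sq_nonneg (v y₀), h0.le, h0.ge]
        exact pow_eq_zero_iff (n := 2) (by norm_num) |>.1 this
      have hv0 : v y₀ = 0 := by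
        have : v y₀ ^ 2 = 0 := by nlinarith [sq_nonneg (u y₀), sq_nonneg (v y₀), h0.le, h0.ge]
        exact pow_eq_zero_iff (n := 2) (by norm_num) |>.1 this
      exact hy₀.2 (hFV₁ (hzero y₀ hy₀V hu0 hv0))
  have hfront : ∀ y ∈ closure V₁, y ∉ V₁ → c₀ / 2 < r2 y := by
    intro y hy hyV₁
    have hyβ : y ∈ tsupport β := subset_tsupport _ (by
      rw [Function.mem_support, hβ1 hy]; exact one_ne_zero)
    have := hc₀le y ⟨hyβ, hyV₁⟩
    linarith
  refine ⟨V₁, c₀ / 2, hV₁o, hFV₁, hclV₁, by linarith, hfront, fun η hη hηle => ?_⟩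
  obtain ⟨hχ₁s, hχ₁01, hχ₁one, hχ₁zero, -⟩ := cutoffProfile_props
  set χ : X → ℝ := fun y => β y * Real.smoothTransition (2 - 2 * (r2 y / η)) with hχ
  have hχs : ContMDiff (𝓡 4) 𝓘(ℝ, ℝ) ∞ χ := by
    have h1 : ContMDiff (𝓡 4) 𝓘(ℝ, ℝ) ∞ fun y => r2 y / η :=
      ((hu.pow 2).add (hv.pow 2)).div_const η
    have h2 : ContMDiff (𝓡 4) 𝓘(ℝ, ℝ) ∞ fun y => Real.smoothTransition (2 - 2 * (r2 y / η)) :=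
      (contMDiff_iff_contDiff.2 hχ₁s).comp h1
    exact β.contMDiff.mul h2
  -- outside `V₁`, `χ = 0`
  have hout : ∀ y ∉ V₁, χ y = 0 := by
    intro y hy
    by_cases hyβ : y ∈ tsupport β
    · have hr : c₀ ≤ r2 y := hc₀le y ⟨hyβ, hy⟩
      have : 1 ≤ r2 y / η := by rw [le_div_iff₀ hη]; linarith
      simp only [hχ, hχ₁zero _ this, mul_zero]
    · have : β y = 0 := image_eq_zero_of_notMem_tsupport hyβ
      simp only [hχ, this, zero_mul]
  refine ⟨χ, hχs, fun y => ?_, fun y hy => ?_, hout⟩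
  · have hb := hβ01 y
    have hc := hχ₁01 (r2 y / η)
    exact ⟨mul_nonneg hb.1 hc.1, by nlinarith [hb.1, hb.2, hc.1, hc.2]⟩
  · have : β y = 1 := hβ1 (subset_closure hy)
    simp only [hχ, this, one_mul, hr2]



end CutoffFrontier

section InterpMirror

/-- **The interpolated corner function has negative `v`-derivative at interior points close to
the corner (chart estimate).**  For
`Ĝ(z) = 1 - 2 z₀ z₁ [(1 - χ₁(r²/η)) K̂(z) + χ₁(r²/η) K̂(stratumProj z)]`, `r² = z₀² + z₁²`, with
`K̂ ≥ m > 0` and `‖dK̂‖ ≤ C` on a ball around a stratum point, `0 ≤ χ₁ ≤ 1`, `|χ₁'| ≤ C_χ`: at a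
point `q` of the ball with `q₀ ≥ 0`, `q₁ > 0`, `r² ≤ η` and `√η · C (1 + 2 C_χ) < m`, the
derivative of
`Ĝ` along the line `s ↦ q + s e₁` (the mirror image of `hasDerivAt_interp_line_neg`) at
`s = 0` is `-2 q₁ (M + q₀ D)` with `M ≥ m` and
`|q₀ D| ≤ √η C (1 + 2C_χ) < m`, hence **negative**. [folklore] -/
theorem hasDerivAt_interp_line_neg' {Kh : EuclideanSpace ℝ (Fin 4) → ℝ} {χ₁ : ℝ → ℝ}
    {η m C Cχ R : ℝ} {qm q : EuclideanSpace ℝ (Fin 4)}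
    (hKd : ∀ z ∈ Metric.ball qm R, DifferentiableAt ℝ Kh z)
    (hKC : ∀ z ∈ Metric.ball qm R, ‖fderiv ℝ Kh z‖ ≤ C)
    (hKm : ∀ z ∈ Metric.ball qm R, m ≤ Kh z) (hC : 0 ≤ C)
    (hχd : Differentiable ℝ χ₁) (hχC : ∀ x, |deriv χ₁ x| ≤ Cχ) (hχ01 : ∀ x, 0 ≤ χ₁ x ∧ χ₁ x ≤ 1)
    (hCχ : 0 ≤ Cχ) (hqm : qm 0 = 0 ∧ qm 1 = 0) (hq : q ∈ Metric.ball qm R) (hq0 : 0 ≤ q 1)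
    (hq1 : 0 < q 0) (hη : 0 < η) (hqη : q 1 ^ 2 + q 0 ^ 2 ≤ η)
    (hsmall : Real.sqrt η * (C * (1 + 2 * Cχ)) < m) :
    ∃ g' : ℝ, g' < 0 ∧ HasDerivAt (fun s : ℝ =>
      1 - 2 * (q 1 + s) * q 0 *
        ((1 - χ₁ (((q 1 + s) ^ 2 + q 0 ^ 2) / η)) * Kh (q + s • EuclideanSpace.single 1 (1:ℝ)) +
          χ₁ (((q 1 + s) ^ 2 + q 0 ^ 2) / η) * Kh (stratumProj q))) g' 0 := by
  set e0 : EuclideanSpace ℝ (Fin 4) := EuclideanSpace.single 1 (1:ℝ) with he0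
  set kc : ℝ := Kh (stratumProj q) with hkc
  set ρ : ℝ → ℝ := fun s => ((q 1 + s) ^ 2 + q 0 ^ 2) / η with hρ
  -- derivatives of the pieces at `0`
  have hρd : HasDerivAt ρ (2 * q 1 / η) 0 := by
    have h1 : HasDerivAt (fun s : ℝ => (q 1 + s) ^ 2 + q 0 ^ 2) (2 * q 1) 0 := by
      have := ((hasDerivAt_id (0:ℝ)).const_add (q 1)).pow 2
      simpa using this.add_const (q 0 ^ 2)
    have := h1.div_const η
    simpa [hρ] using this
  have hρ0 : ρ 0 = (q 1 ^ 2 + q 0 ^ 2) / η := by simp [hρ]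
  set χ0 : ℝ := χ₁ (ρ 0) with hχ0
  set χ' : ℝ := deriv χ₁ (ρ 0) with hχ'
  have hχsd : HasDerivAt (fun s => χ₁ (ρ s)) (χ' * (2 * q 1 / η)) 0 :=
    (hχd (ρ 0)).hasDerivAt.comp 0 hρd
  set dK : ℝ := fderiv ℝ Kh q e0 with hdK
  have hKline : HasDerivAt (fun s : ℝ => Kh (q + s • e0)) dK 0 := by
    have h := (hKd q hq).hasFDerivAt.hasLineDerivAt e0
    unfold HasLineDerivAt at h
    exact h
  -- the bracket and its derivative
  set M : ℝ := (1 - χ0) * Kh q + χ0 * kc with hM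
  set D : ℝ := (1 - χ0) * dK + χ' * (2 * q 1 / η) * (kc - Kh q) with hD
  have hBd : HasDerivAt (fun s => (1 - χ₁ (ρ s)) * Kh (q + s • e0) + χ₁ (ρ s) * kc) D 0 := by
    have h1 := ((hasDerivAt_const (0:ℝ) (1:ℝ)).sub hχsd).mul hKline
    have h2 := hχsd.mul_const kc
    have h := h1.add h2
    refine h.congr_deriv ?_
    simp only [hD, hχ0, hχ', Pi.sub_apply, zero_smul, add_zero]
    ring
  -- the whole line function
  have hgd : HasDerivAt (fun s : ℝ => 1 - 2 * (q 1 + s) * q 0 *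
      ((1 - χ₁ (ρ s)) * Kh (q + s • e0) + χ₁ (ρ s) * kc)) (-(2 * q 0 * (M + q 1 * D))) 0 := by
    have h1 : HasDerivAt (fun s : ℝ => 2 * (q 1 + s) * q 0) (2 * q 0) 0 := by
      have := (((hasDerivAt_id (0:ℝ)).const_add (q 1)).const_mul 2).mul_const (q 0)
      simpa using this
    have h := (hasDerivAt_const (0:ℝ) (1:ℝ)).sub (h1.mul hBd)
    refine h.congr_deriv ?_
    simp only [hM, hχ0, add_zero, zero_smul]
    ring
  -- ### the estimate
  have hr : Real.sqrt (q 1 ^ 2 + q 0 ^ 2) ≤ Real.sqrt η := Real.sqrt_le_sqrt hqη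
  have hq0le : q 1 ≤ Real.sqrt η := by
    have h1 : q 1 = Real.sqrt (q 1 ^ 2) := by rw [Real.sqrt_sq hq0]
    have h2 : Real.sqrt (q 1 ^ 2) ≤ Real.sqrt (q 1 ^ 2 + q 0 ^ 2) :=
      Real.sqrt_le_sqrt (by nlinarith)
    linarith [h2.trans hr]
  have hq0sq : q 1 ^ 2 ≤ η := by nlinarith
  -- `|dK| ≤ C`
  have hdKle : |dK| ≤ C := by
    have h := (fderiv ℝ Kh q).le_opNorm e0
    have hn : ‖e0‖ = 1 := by
      rw [he0, EuclideanSpace.norm_eq]; simp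
    rw [hn, mul_one] at h
    rw [hdK, ← Real.norm_eq_abs]
    exact h.trans (hKC q hq)
  -- `|kc - K̂ q| ≤ C √η`
  have hsPmem : stratumProj q ∈ Metric.ball qm R := by
    rw [Metric.mem_ball, dist_eq_norm] at hq ⊢
    exact (norm_stratumProj_sub_le hqm.1 hqm.2).trans_lt hq
  have hkcle : |kc - Kh q| ≤ C * Real.sqrt η := by
    have hmvt := (convex_ball qm R).norm_image_sub_le_of_norm_fderiv_le (𝕜 := ℝ) (f := Kh)
      (fun z hz => hKd z hz) (fun z hz => hKC z hz) hq hsPmem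
    rw [Real.norm_eq_abs] at hmvt
    have hnorm : ‖stratumProj q - q‖ = Real.sqrt (q 1 ^ 2 + q 0 ^ 2) := by
      rw [show q 1 ^ 2 + q 0 ^ 2 = q 0 ^ 2 + q 1 ^ 2 from add_comm _ _,
        ← norm_stratumProj_sub_sq, Real.sqrt_sq (norm_nonneg _)]
    rw [hnorm] at hmvt
    exact hmvt.trans (mul_le_mul_of_nonneg_left hr hC)
  -- `|q₀ D| ≤ √η C (1 + 2 Cχ)`
  have hχ'le : |χ'| ≤ Cχ := hχC _
  have hχ0mem := hχ01 (ρ 0)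
  have hD1 : |q 1 * ((1 - χ0) * dK)| ≤ Real.sqrt η * C := by
    rw [abs_mul, abs_mul, abs_of_nonneg hq0]
    have h1 : |1 - χ0| ≤ 1 := by
      rw [abs_le]; exact ⟨by linarith [hχ0mem.2], by linarith [hχ0mem.1]⟩
    have h2 : |1 - χ0| * |dK| ≤ 1 * C := mul_le_mul h1 hdKle (abs_nonneg _) zero_le_one
    rw [one_mul] at h2
    exact mul_le_mul hq0le h2 (mul_nonneg (abs_nonneg _) (abs_nonneg _)) (Real.sqrt_nonneg _)
  have hD2 : |q 1 * (χ' * (2 * q 1 / η) * (kc - Kh q))| ≤ 2 * Cχ * C * Real.sqrt η := by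
    rw [abs_mul, abs_mul, abs_mul, abs_of_nonneg hq0,
      abs_of_nonneg (show 0 ≤ 2 * q 1 / η by positivity)]
    have h1 : q 1 * (|χ'| * (2 * q 1 / η) * |kc - Kh q|) ≤
        q 1 * (Cχ * (2 * q 1 / η) * (C * Real.sqrt η)) := by
      gcongr
    have h2 : q 1 * (Cχ * (2 * q 1 / η) * (C * Real.sqrt η)) =
        (q 1 ^ 2 / η) * (2 * Cχ * C * Real.sqrt η) := by
      ring
    have h3 : q 1 ^ 2 / η ≤ 1 := (div_le_one hη).2 hq0sq
    have h4 : (q 1 ^ 2 / η) * (2 * Cχ * C * Real.sqrt η) ≤ 1 * (2 * Cχ * C * Real.sqrt η) :=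
      mul_le_mul_of_nonneg_right h3 (by positivity)
    linarith
  have hq0D : |q 1 * D| ≤ Real.sqrt η * (C * (1 + 2 * Cχ)) := by
    have : q 1 * D = q 1 * ((1 - χ0) * dK) + q 1 * (χ' * (2 * q 1 / η) * (kc - Kh q)) := by
      rw [hD]; ring
    rw [this]
    refine (abs_add_le _ _).trans ?_
    nlinarith [hD1, hD2, Real.sqrt_nonneg η]
  -- `M ≥ m`
  have hMge : m ≤ M := by
    have h1 : m ≤ Kh q := hKm q hq
    have h2 : m ≤ kc := hKm _ hsPmem
    rw [hM]; nlinarith [hχ0mem.1, hχ0mem.2]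
  have hpos : 0 < M + q 1 * D := by
    have := neg_abs_le (q 1 * D)
    linarith
  exact ⟨-(2 * q 0 * (M + q 1 * D)), by nlinarith [mul_pos hq1 hpos], hgd⟩



end InterpMirror

section UniformConstants

variable {X : Type u} [TopologicalSpace X] [ChartedSpace (EuclideanSpace ℝ (Fin 4)) X]

/-- **Uniform constants for `K` read in corner-slice charts along the central surface.**  Given
corner-slice charts at the points of the compact corner locus `F`, a smooth `K` positive on an
open `O_K ⊇ F`, and a closed set `Z₀` (e.g. `S ∩ V̄₁`) whose points with `u = v = 0` lie in
`F`: there are `m > 0`, `C ≥ 0` and `η₁ > 0` such that every point `y ∈ Z₀` with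
`u² + v² ≤ η₁` lies in the domain of one of finitely many of the charts, its image in a ball
`B(q_m, R)` around a stratum point contained in the target, on which `K ∘ Θ⁻¹` is
differentiable with `‖d(K ∘ Θ⁻¹)‖ ≤ C` and `K ∘ Θ⁻¹ ≥ m` (finite subcover of `F`; on each closed
ball the bounds are attained by compactness). [folklore] -/
theorem exists_uniform_chart_constants {Sset F : Set X} {u v : X → ℝ} {π : X → X}
    (hFc : IsCompact F)
    (hcd : ∀ x ∈ F, ∃ C : CornerSliceChart Sset F u v π, x ∈ C.Θ.source)
    {K : X → ℝ} (hKs : ContMDiff (𝓡 4) 𝓘(ℝ, ℝ) ∞ K) {O_K : Set X} (hOKo : IsOpen O_K)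
    (hFOK : F ⊆ O_K) (hKpos : ∀ y ∈ O_K, 0 < K y)
    (hu : Continuous u) (hv : Continuous v)
    {Z₀ : Set X} (hZ₀c : IsCompact Z₀) (hzeroF : ∀ y ∈ Z₀, u y = 0 → v y = 0 → y ∈ F) :
    ∃ (m C η₁ : ℝ), 0 < m ∧ 0 ≤ C ∧ 0 < η₁ ∧
      ∀ y ∈ Z₀, u y ^ 2 + v y ^ 2 ≤ η₁ →
        ∃ (Cc : CornerSliceChart Sset F u v π) (qm : EuclideanSpace ℝ (Fin 4)) (R : ℝ),
          y ∈ Cc.Θ.source ∧ Cc.Θ y ∈ Metric.ball qm R ∧ Metric.ball qm R ⊆ Cc.Θ.target ∧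
          qm 0 = 0 ∧ qm 1 = 0 ∧ (∀ z ∈ Metric.ball qm R, Cc.Θ.symm z ∈ O_K) ∧
          ∀ z ∈ Metric.ball qm R, DifferentiableAt ℝ (K ∘ Cc.Θ.symm) z ∧
            ‖fderiv ℝ (K ∘ Cc.Θ.symm) z‖ ≤ C ∧ m ≤ K (Cc.Θ.symm z) := by
  -- ### local data at each point of `F`
  have hloc : ∀ x : F, ∃ (Cc : CornerSliceChart Sset F u v π) (R mx Cx : ℝ),
      (x : X) ∈ Cc.Θ.source ∧ 0 < R ∧ 0 < mx ∧ 0 ≤ Cx ∧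
      Metric.closedBall (Cc.Θ x) R ⊆ Cc.Θ.target ∧ Cc.Θ x 0 = 0 ∧ Cc.Θ x 1 = 0 ∧
      (∀ z ∈ Metric.closedBall (Cc.Θ x) R, Cc.Θ.symm z ∈ O_K) ∧
      ∀ z ∈ Metric.closedBall (Cc.Θ x) R, DifferentiableAt ℝ (K ∘ Cc.Θ.symm) z ∧
        ‖fderiv ℝ (K ∘ Cc.Θ.symm) z‖ ≤ Cx ∧ mx ≤ K (Cc.Θ.symm z) := by
    intro x
    obtain ⟨Cc, hxC⟩ := hcd x x.2
    set qx := Cc.Θ x with hqx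
    obtain ⟨hu0, hv0⟩ := (Cc.mem_K_iff x hxC).1 x.2
    have hq0 : qx 0 = 0 := by rw [hqx, Cc.apply_zero x hxC, hu0]
    have hq1 : qx 1 = 0 := by rw [hqx, Cc.apply_one x hxC, hv0]
    -- `K ∘ Θ⁻¹` is smooth on the target
    have hKh : ContDiffOn ℝ ∞ (K ∘ Cc.Θ.symm) Cc.Θ.target :=
      contMDiffOn_iff_contDiffOn.mp (hKs.comp_contMDiffOn Cc.contMDiffOn_symm)
    -- a closed ball inside the target whose points come from `O_K`
    set D : Set (EuclideanSpace ℝ (Fin 4)) := Cc.Θ.target ∩ Cc.Θ.symm ⁻¹' O_K with hD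
    have hDo : IsOpen D := Cc.Θ.continuousOn_symm.isOpen_inter_preimage Cc.Θ.open_target hOKo
    have hqD : qx ∈ D := ⟨Cc.Θ.map_source hxC, by
      show Cc.Θ.symm (Cc.Θ x) ∈ O_K; rw [Cc.Θ.left_inv hxC]; exact hFOK x.2⟩
    obtain ⟨R, hR, hball⟩ := Metric.nhds_basis_closedBall.mem_iff.1 (hDo.mem_nhds hqD)
    have hcpt : IsCompact (Metric.closedBall qx R) := isCompact_closedBall _ _
    -- bounds on the closed ball
    have hcontK : ContinuousOn (K ∘ Cc.Θ.symm) (Metric.closedBall qx R) :=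
      hKh.continuousOn.mono fun z hz => (hball hz).1
    have hcontd : ContinuousOn (fun z => fderiv ℝ (K ∘ Cc.Θ.symm) z) (Metric.closedBall qx R) :=
      (hKh.continuousOn_fderiv_of_isOpen Cc.Θ.open_target (by simp)).mono fun z hz => (hball hz).1
    obtain ⟨Cx, hCx⟩ := hcpt.exists_bound_of_continuousOn hcontd
    obtain ⟨z₀, hz₀, hmin⟩ := hcpt.exists_isMinOn ⟨qx, Metric.mem_closedBall_self hR.le⟩ hcontK
    refine ⟨Cc, R, K (Cc.Θ.symm z₀), max Cx 0, hxC, hR, hKpos _ (hball hz₀).2, le_max_right _ _,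
      fun z hz => (hball hz).1, hq0, hq1, fun z hz => (hball hz).2, fun z hz => ⟨?_, ?_, ?_⟩⟩
    · exact (hKh.contDiffAt (Cc.Θ.open_target.mem_nhds (hball hz).1)).differentiableAt (by simp)
    · exact (hCx z hz).trans (le_max_left _ _)
    · exact hmin hz
  choose Cc R mF CF hxC hRpos hmFpos hCFnn hballT hq0 hq1 hballOK hbounds using hloc
  -- ### a finite subcover of `F`
  set Vx : F → Set X := fun x => (Cc x).Θ.source ∩ (Cc x).Θ ⁻¹' Metric.ball ((Cc x).Θ x) (R x / 2)
    with hVx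
  have hVxo : ∀ x, IsOpen (Vx x) := fun x =>
    (Cc x).Θ.continuousOn.isOpen_inter_preimage (Cc x).Θ.open_source Metric.isOpen_ball
  have hxVx : ∀ x : F, (x : X) ∈ Vx x := fun x =>
    ⟨hxC x, by
      show (Cc x).Θ x ∈ Metric.ball ((Cc x).Θ x) (R x / 2)
      exact Metric.mem_ball_self (by linarith [hRpos x])⟩
  obtain ⟨t, ht⟩ := hFc.elim_finite_subcover Vx hVxo
    (fun x hx => mem_iUnion.2 ⟨⟨x, hx⟩, hxVx ⟨x, hx⟩⟩)
  -- the uniform constants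
  set m : ℝ := (insert (1:ℝ) (t.image mF)).min' (Finset.insert_nonempty _ _) with hm
  set C : ℝ := (insert (0:ℝ) (t.image CF)).max' (Finset.insert_nonempty _ _) with hC
  have hmle : ∀ x ∈ t, m ≤ mF x := fun x hx =>
    Finset.min'_le _ _ (Finset.mem_insert_of_mem (Finset.mem_image_of_mem _ hx))
  have hCle : ∀ x ∈ t, CF x ≤ C := fun x hx =>
    Finset.le_max' _ _ (Finset.mem_insert_of_mem (Finset.mem_image_of_mem _ hx))
  have hmpos : 0 < m := by
    have hmem := Finset.min'_mem (insert (1:ℝ) (t.image mF)) (Finset.insert_nonempty _ _)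
    rw [← hm] at hmem
    rcases Finset.mem_insert.1 hmem with h1 | h1
    · rw [h1]; exact one_pos
    · obtain ⟨x, -, hx⟩ := Finset.mem_image.1 h1
      rw [← hx]; exact hmFpos x
  have hCnn : 0 ≤ C := Finset.le_max' _ _ (Finset.mem_insert_self _ _)
  -- ### the radius `η₁`: small `u² + v²` on `Z₀` forces membership in the subcover
  set Z : Set X := Z₀ \ ⋃ x ∈ t, Vx x with hZ
  have hZc : IsCompact Z := hZ₀c.diff (isOpen_biUnion fun x _ => hVxo x)
  have hr2c : Continuous fun y => u y ^ 2 + v y ^ 2 := (hu.pow 2).add (hv.pow 2)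
  obtain ⟨η₁, hη₁, hη₁Z⟩ : ∃ η₁ : ℝ, 0 < η₁ ∧ ∀ y ∈ Z, η₁ < u y ^ 2 + v y ^ 2 := by
    rcases Z.eq_empty_or_nonempty with hZe | hZne
    · exact ⟨1, one_pos, fun y hy => by rw [hZe] at hy; exact absurd hy (notMem_empty _)⟩
    · obtain ⟨y₀, hy₀, hmin⟩ := hZc.exists_isMinOn hZne hr2c.continuousOn
      have hpos : 0 < u y₀ ^ 2 + v y₀ ^ 2 := by
        by_contra hle
        have h0 : u y₀ ^ 2 + v y₀ ^ 2 = 0 := le_antisymm (not_lt.1 hle) (by positivity)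
        have hu0 : u y₀ = 0 := by nlinarith [sq_nonneg (u y₀), sq_nonneg (v y₀)]
        have hv0 : v y₀ = 0 := by nlinarith [sq_nonneg (u y₀), sq_nonneg (v y₀)]
        have hyF : y₀ ∈ F := hzeroF y₀ hy₀.1 hu0 hv0
        exact hy₀.2 (ht hyF)
      refine ⟨(u y₀ ^ 2 + v y₀ ^ 2) / 2, by linarith, fun y hy => ?_⟩
      have := hmin hy
      rw [mem_setOf_eq] at this
      linarith
  refine ⟨m, C, η₁, hmpos, hCnn, hη₁, fun y hy hyr => ?_⟩
  -- `y` lies in some `Vx x`, `x ∈ t`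
  have hyU : y ∈ ⋃ x ∈ t, Vx x := by
    by_contra hnot
    exact absurd hyr (not_le.2 (hη₁Z y ⟨hy, hnot⟩))
  obtain ⟨x, hxt, hyV⟩ := mem_iUnion₂.1 hyU
  obtain ⟨hysrc, hyball⟩ := hyV
  have hyball' : (Cc x).Θ y ∈ Metric.ball ((Cc x).Θ x) (R x) :=
    Metric.ball_subset_ball (by linarith [hRpos x]) hyball
  have hsub : Metric.ball ((Cc x).Θ x) (R x) ⊆ Metric.closedBall ((Cc x).Θ x) (R x) :=
    Metric.ball_subset_closedBall
  refine ⟨Cc x, (Cc x).Θ x, R x, hysrc, hyball', fun z hz => hballT x (hsub hz), hq0 x, hq1 x,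
    fun z hz => hballOK x z (hsub hz), fun z hz => ?_⟩
  obtain ⟨h1, h2, h3⟩ := hbounds x z (hsub hz)
  exact ⟨h1, h2.trans (hCle x hxt), (hmle x hxt).trans h3⟩

end UniformConstants

section Assembly

variable {X : Type u} [TopologicalSpace X] [T2Space X] [CompactSpace X]
  [ChartedSpace (EuclideanSpace ℝ (Fin 4)) X] [IsManifold (𝓡 4) ∞ X]
  {g : ℕ} {k : Fin 3 → ℕ} {S : Fin 3 → Set X}

/-- **A sector in normal form carries the handle decomposition of its sector manifold**
(input form of `IsGKTrisection.exists_cornerSliceAtlas_hasHandleDecomposition`).  Data: the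
sector manifold `e : W → X` of `S i` (embedding onto `S i`, corner charts over `F = ⋂ S m`,
faces `S i ∩ S j` images of boundary points, immersion off `F`) with a Morse function `f`
adapted to `∂W` and critical-point counts `c`; normal coordinates `u, v` cutting out `S i`, its
faces and `F` in an open `U ⊇ F`; a smooth retraction `ρ` of an open `O` (`F ⊆ O ⊆ U`) into
`F`; and a corner-slice atlas `Φ` of `S i` relative to `(F, u, v, ρ)` with corner sources in
`O`.  Conclusion: a corner-slice atlas `Φ'` (the corner charts of `Φ` shrunk, the half-slice
charts unchanged) for whose straightened structure `↥(S i)` has a handle decomposition with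
counts `c` — presented by the ambient function
`G = 1 - (1 - χ)(1 - F_ext) - χ · 2uv · K ∘ ρ` described in the module docstring.
[cite: GayKirby2016, Def. 1; Milnor1963, §§2–3] -/
theorem hasHandleDecomposition_of_normalForm {i : Fin 3}
    {W : Type u} [TopologicalSpace W] [ChartedSpace (EuclideanHalfSpace 4) W]
    [IsManifold (𝓡∂ 4) ∞ W] [CompactSpace W]
    {e : W → X} (he : Topology.IsEmbedding e) (hrange : range e = S i)
    (himm : ∀ w, e w ∉ (⋂ m, S m) → Manifold.IsImmersionAt (𝓡∂ 4) (𝓡 4) ∞ e w)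
    (hcor : ∀ w, e w ∈ (⋂ m, S m) → IsCornerAt e w)
    (hbd : ∀ j, j ≠ i → S i ∩ S j ⊆ e '' (𝓡∂ 4).boundary W)
    {f : W → ℝ} (hf : IsMorseAdapted (𝓡∂ 4) f) {c : ℕ → ℕ}
    (hcount : ∀ n, (criticalSetOfIndex (𝓡∂ 4) f n).ncard = c n)
    {u v : X → ℝ} (hu : ContMDiff (𝓡 4) 𝓘(ℝ, ℝ) ∞ u) (hv : ContMDiff (𝓡 4) 𝓘(ℝ, ℝ) ∞ v)
    {U : Set X} (hUo : IsOpen U)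
    (hSi : ∀ y ∈ U, y ∈ S i ↔ 0 ≤ u y ∧ 0 ≤ v y)
    (hF : ∀ y ∈ U, y ∈ (⋂ m, S m) ↔ u y = 0 ∧ v y = 0)
    (hface : ∀ y ∈ U, y ∈ S i → (u y = 0 ∨ v y = 0) → ∃ j', j' ≠ i ∧ y ∈ S j')
    (hFc : IsCompact (⋂ m, S m))
    {O : Set X} {ρ : X → X} (hOo : IsOpen O) (hFO : (⋂ m, S m) ⊆ O) (hOU : O ⊆ U)
    (hρs : ContMDiff (𝓡 4) (𝓡 4) ∞ ρ) (hρF : ∀ y ∈ O, ρ y ∈ ⋂ m, S m)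
    (Φ : CornerSliceAtlas (S i) (⋂ m, S m) u v ρ)
    (hΦO : ∀ (p : ↥(S i)) (hp : p.1 ∈ ⋂ m, S m), (Φ.cornerDatum p hp).Θ.source ⊆ O) :
    ∃ Φ' : CornerSliceAtlas (S i) (⋂ m, S m) u v ρ,
      (∀ (p : ↥(S i)) (hp : p.1 ∈ ⋂ m, S m), (Φ'.cornerDatum p hp).Θ.source ⊆ O) ∧
      (letI := Φ'.chartedSpace; HasHandleDecomposition 3 ↥(S i) c) := by
  -- abbreviate the central surface (reverting the data whose types mention it)
  revert himm hcor hF hFc hFO hρF Φ hΦO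
  set F : Set X := ⋂ m, S m with hFdef
  intro himm hcor hF hFc hFO hρF Φ hΦO
  have hFclosed : IsClosed F := hFc.isClosed
  have hFU : F ⊆ U := hFO.trans hOU
  have hSic : IsCompact (S i) := by rw [← hrange]; exact isCompact_range he.continuous
  have hSiclosed : IsClosed (S i) := hSic.isClosed
  -- charts adapted to `(u, v)` along `F`, from the corner data of `Φ`
  have hchart : ∀ x ∈ F, ∃ Ξ : OpenPartialHomeomorph X (EuclideanSpace ℝ (Fin 4)),
      Ξ ∈ IsManifold.maximalAtlas (𝓡 4) ∞ X ∧ x ∈ Ξ.source ∧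
      ∀ y ∈ Ξ.source, Ξ y 0 = u y ∧ Ξ y 1 = v y := by
    intro x hx
    have hxS : x ∈ S i := mem_iInter.1 hx i
    set C := Φ.cornerDatum ⟨x, hxS⟩ hx
    exact ⟨C.Θ, C.Θ_mem_maximalAtlas, Φ.corner_mem_source ⟨x, hxS⟩ hx,
      fun y hy => ⟨C.apply_zero y hy, C.apply_one y hy⟩⟩
  -- ### the cornered Hadamard lemma along `F`
  obtain ⟨O_K, K, hOKo, hFOK, hKs, hKpos, hKid⟩ :=
    exists_cornerHadamard_global he hrange hcor hbd hf hUo hSi hF hface hFU hFc hchart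
  -- ### the cutoff data
  set V : Set X := O ∩ O_K with hV
  have hVo : IsOpen V := hOo.inter hOKo
  have hFV : F ⊆ V := fun x hx => ⟨hFO hx, hFOK hx⟩
  have hVzero : ∀ y ∈ V, u y = 0 → v y = 0 → y ∈ F := fun y hy hu0 hv0 =>
    (hF y (hOU hy.1)).2 ⟨hu0, hv0⟩
  obtain ⟨V₁, η₀, hV₁o, hFV₁, hclV₁, hη₀, hfront, hcut⟩ :=
    exists_localised_cutoff' hFclosed hVo hFV hu hv hVzero
  have hV₁V : V₁ ⊆ V := subset_closure.trans hclV₁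
  -- ### uniform chart constants on `S i ∩ closure V₁`
  have hcd : ∀ x ∈ F, ∃ C : CornerSliceChart (S i) F u v ρ, x ∈ C.Θ.source := fun x hx =>
    ⟨Φ.cornerDatum ⟨x, mem_iInter.1 hx i⟩ hx, Φ.corner_mem_source _ hx⟩
  have hZ₀c : IsCompact (S i ∩ closure V₁) := hSic.inter_right isClosed_closure
  have hzeroF : ∀ y ∈ S i ∩ closure V₁, u y = 0 → v y = 0 → y ∈ F := fun y hy hu0 hv0 =>
    hVzero y (hclV₁ hy.2) hu0 hv0
  obtain ⟨m, C, η₁, hm, hC, hη₁, hconst⟩ := exists_uniform_chart_constants hFc hcd hKs hOKo hFOK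
    hKpos hu.continuous hv.continuous hZ₀c hzeroF
  -- ### the critical points of `f` stay away from `F`
  have hr2c : Continuous fun y => u y ^ 2 + v y ^ 2 :=
    (hu.continuous.pow 2).add (hv.continuous.pow 2)
  obtain ⟨η₂, hη₂, hη₂crit⟩ : ∃ η₂ : ℝ, 0 < η₂ ∧
      ∀ w, IsMCriticalPt (𝓡∂ 4) f w → e w ∈ closure V₁ → η₂ < u (e w) ^ 2 + v (e w) ^ 2 := by
    have hcl : IsClosed (criticalSet (𝓡∂ 4) f) :=
      isClosed_criticalSet_of_contMDiff hf.isMorse.contMDiff (by norm_cast)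
    set Z₂ : Set X := e '' criticalSet (𝓡∂ 4) f ∩ closure V₁ with hZ₂
    have hZ₂c : IsCompact Z₂ := (hcl.isCompact.image he.continuous).inter_right isClosed_closure
    rcases Z₂.eq_empty_or_nonempty with hZe | hZne
    · refine ⟨1, one_pos, fun w hw hwcl => ?_⟩
      have : e w ∈ Z₂ := ⟨⟨w, hw, rfl⟩, hwcl⟩
      rw [hZe] at this; exact absurd this (notMem_empty _)
    · obtain ⟨y₀, hy₀, hmin⟩ := hZ₂c.exists_isMinOn hZne hr2c.continuousOn
      obtain ⟨⟨w₀, hw₀crit, hw₀y⟩, hy₀cl⟩ := hy₀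
      have hpos : 0 < u y₀ ^ 2 + v y₀ ^ 2 := by
        by_contra hle
        have h0 : u y₀ ^ 2 + v y₀ ^ 2 = 0 := le_antisymm (not_lt.1 hle) (by positivity)
        have hu0 : u y₀ = 0 := by nlinarith [sq_nonneg (u y₀), sq_nonneg (v y₀)]
        have hv0 : v y₀ = 0 := by nlinarith [sq_nonneg (u y₀), sq_nonneg (v y₀)]
        have hy₀S : y₀ ∈ S i := by rw [← hrange, ← hw₀y]; exact mem_range_self _
        have hyF : y₀ ∈ F := hzeroF y₀ ⟨hy₀S, hy₀cl⟩ hu0 hv0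
        -- a point over `F` is a boundary point, hence regular
        obtain ⟨j', hj', hyj'⟩ := hface y₀ (hFU hyF) hy₀S (Or.inl hu0)
        obtain ⟨w', hw'b, hw'e⟩ := hbd j' hj' ⟨hy₀S, hyj'⟩
        rw [← hw₀y] at hw'e
        rw [he.injective hw'e] at hw'b
        exact (hf.2.1 w₀ hw'b).2 hw₀crit
      refine ⟨(u y₀ ^ 2 + v y₀ ^ 2) / 2, by linarith, fun w hw hwcl => ?_⟩
      have := hmin (show e w ∈ Z₂ from ⟨⟨w, hw, rfl⟩, hwcl⟩)
      rw [mem_setOf_eq] at this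
      linarith
  -- ### the cutoff profile constant and the choice of `η`
  obtain ⟨hχ₁s, hχ₁01, hχ₁one, hχ₁zero, Cχ, hCχ, hχ₁C⟩ := cutoffProfile_props
  -- `η` small: below `η₀`, `η₁`, `η₂` and the no-critical-point threshold
  obtain ⟨η, hη, hηη₀, hηη₁, hηη₂, hηsmall⟩ : ∃ η : ℝ, 0 < η ∧ η ≤ η₀ ∧ η ≤ η₁ ∧ η ≤ η₂ ∧
      Real.sqrt η * (C * (1 + 2 * Cχ)) < m := by
    set A : ℝ := C * (1 + 2 * Cχ) with hA
    have hA0 : 0 ≤ A := by positivity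
    set s₀ : ℝ := m / (2 * (A + 1)) with hs₀
    have hs₀pos : 0 < s₀ := by positivity
    set η' : ℝ := min (min (min η₀ η₁) η₂) (s₀ ^ 2) with hη'
    refine ⟨η', lt_min (lt_min (lt_min hη₀ hη₁) hη₂) (by positivity),
      (min_le_left _ _).trans ((min_le_left _ _).trans (min_le_left _ _)),
      (min_le_left _ _).trans ((min_le_left _ _).trans (min_le_right _ _)),
      (min_le_left _ _).trans (min_le_right _ _), ?_⟩
    have h1 : Real.sqrt η' ≤ s₀ := by
      calc Real.sqrt η' ≤ Real.sqrt (s₀ ^ 2) := Real.sqrt_le_sqrt (min_le_right _ _)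
        _ = s₀ := Real.sqrt_sq hs₀pos.le
    calc Real.sqrt η' * A ≤ s₀ * A := mul_le_mul_of_nonneg_right h1 hA0
      _ = m * (A / (2 * (A + 1))) := by rw [hs₀]; ring
      _ < m * 1 := by
          refine mul_lt_mul_of_pos_left ?_ hm
          rw [div_lt_one (by positivity)]; linarith
      _ = m := mul_one m
  -- ### the cutoff `χ`
  obtain ⟨χ, hχs, hχ01, hχV₁, hχout⟩ := hcut η hη hηη₀
  -- ### the extension of `f` off a small neighbourhood `V₀` of `F`
  set r2 : X → ℝ := fun y => u y ^ 2 + v y ^ 2 with hr2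
  have hr2s : ContMDiff (𝓡 4) 𝓘(ℝ, ℝ) ∞ r2 := (hu.pow 2).add (hv.pow 2)
  set V₀ : Set X := V₁ ∩ r2 ⁻¹' Iio (η / 4) with hV₀
  have hV₀o : IsOpen V₀ := hV₁o.inter (isOpen_Iio.preimage hr2s.continuous)
  have hFV₀ : F ⊆ V₀ := fun x hx => ⟨hFV₁ hx, by
    obtain ⟨hu0, hv0⟩ := (hF x (hFU hx)).1 hx
    show r2 x < η / 4; simp only [hr2, hu0, hv0]; norm_num; linarith⟩
  have himm' : ∀ w, e w ∉ F → Manifold.IsImmersionAt (𝓡∂ 4) (𝓡 4) ∞ e w := himm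
  have hrangec : IsClosed (range e) := by rw [hrange]; exact hSiclosed
  obtain ⟨Fext, hFexts, hFextf⟩ := exists_contMDiff_extension_off he hrangec himm'
    hf.isMorse.contMDiff hV₀o hFV₀
  -- ### the ambient function
  set G : X → ℝ := fun y => 1 - (1 - χ y) * (1 - Fext y) - χ y * (2 * u y * v y * K (ρ y)) with hG
  have hGs : ContMDiff (𝓡 4) 𝓘(ℝ, ℝ) ∞ G :=
    (contMDiff_const.sub ((contMDiff_const.sub hχs).mul (contMDiff_const.sub hFexts))).sub
      (hχs.mul (((contMDiff_const.mul hu).mul hv).mul (hKs.comp hρs)))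
  -- ### the formula on `S i ∩ V₁`
  have hformula : ∀ w, e w ∈ V₁ →
      G (e w) = 1 - 2 * u (e w) * v (e w) * ((1 - χ (e w)) * K (e w) + χ (e w) * K (ρ (e w))) := by
    intro w hw
    set y := e w with hy
    have hyOK : y ∈ O_K := (hV₁V hw).2
    by_cases hV : y ∈ V₀
    · -- here `χ = 1`
      have hχ1 : χ y = 1 := by
        rw [hχV₁ y hw]
        apply hχ₁one
        have : r2 y < η / 4 := hV.2
        rw [div_le_iff₀ hη]; simp only [hr2] at this; linarith
      simp only [hG, hχ1, sub_self, zero_mul, sub_zero, one_mul, zero_add]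
    · have hFf : Fext y = f w := hFextf w hV
      have hid : 1 - f w = 2 * u y * v y * K y := hKid w hyOK
      simp only [hG, hFf]
      rw [hid]; ring
  -- ### interior points of `S i` (in `X`) versus interior points of `W`
  have hWint : ∀ w, e w ∉ F → (e w ∈ interior (S i) ↔ (𝓡∂ 4).IsInteriorPoint w) := by
    intro w hwF
    constructor
    · intro hint
      rw [← hrange] at hint
      exact (apply_lt_one_of_mem_interior_range he hf (himm w hwF) hint).2
    · intro hint
      rw [← hrange]
      exact apply_mem_interior_range_of_isInteriorPoint (himm w hwF) hint
  have hflt : ∀ w, e w ∉ F → e w ∈ interior (S i) → f w < 1 := fun w hwF hint =>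
    (apply_lt_one_of_mem_interior_range he hf (himm w hwF) (by rw [hrange]; exact hint)).1
  have hfone : ∀ w, e w ∉ F → e w ∉ interior (S i) → f w = 1 := by
    intro w hwF hnot
    have hbw : (𝓡∂ 4).IsBoundaryPoint w := by
      rw [ModelWithCorners.isBoundaryPoint_iff_not_isInteriorPoint]
      exact fun hint => hnot ((hWint w hwF).2 hint)
    exact (hf.2.1 w hbw).1
  -- interior points of `S i` inside `U` have `u, v > 0`; non-interior points have `u v = 0`
  have huvpos : ∀ w, e w ∉ F → e w ∈ U → e w ∈ interior (S i) → 0 < u (e w) ∧ 0 < v (e w) := by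
    intro w hwF hyU hint
    have hyS : e w ∈ S i := by rw [← hrange]; exact mem_range_self w
    obtain ⟨hu0, hv0⟩ := (hSi _ hyU).1 hyS
    have hwint : (𝓡∂ 4).IsInteriorPoint w := (hWint w hwF).1 hint
    have hnotbd : ∀ j', j' ≠ i → e w ∉ S j' := by
      intro j' hj' hmem
      obtain ⟨w', hw'b, hw'e⟩ := hbd j' hj' ⟨hyS, hmem⟩
      rw [he.injective hw'e] at hw'b
      exact (ModelWithCorners.isInteriorPoint_iff_not_isBoundaryPoint _ |>.1 hwint) hw'b
    refine ⟨lt_of_le_of_ne hu0 fun h0 => ?_, lt_of_le_of_ne hv0 fun h0 => ?_⟩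
    · obtain ⟨j', hj', hmem⟩ := hface _ hyU hyS (Or.inl h0.symm)
      exact hnotbd j' hj' hmem
    · obtain ⟨j', hj', hmem⟩ := hface _ hyU hyS (Or.inr h0.symm)
      exact hnotbd j' hj' hmem
  have huvzero : ∀ y ∈ S i, y ∈ U → y ∉ interior (S i) → u y * v y = 0 := by
    intro y hyS hyU hnot
    obtain ⟨hu0, hv0⟩ := (hSi y hyU).1 hyS
    by_contra hne
    have hu' : 0 < u y := lt_of_le_of_ne hu0 fun h0 => hne (by rw [← h0, zero_mul])
    have hv' : 0 < v y := lt_of_le_of_ne hv0 fun h0 => hne (by rw [← h0, mul_zero])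
    apply hnot
    have hopen : IsOpen (U ∩ (u ⁻¹' Ioi 0 ∩ v ⁻¹' Ioi 0)) :=
      hUo.inter ((isOpen_Ioi.preimage hu.continuous).inter (isOpen_Ioi.preimage hv.continuous))
    exact mem_interior.2 ⟨_, fun z hz => (hSi z hz.1).2 ⟨le_of_lt hz.2.1, le_of_lt hz.2.2⟩, hopen,
      ⟨hyU, hu', hv'⟩⟩
  -- ### the shrunk corner data: sources inside `V₁` with `χ = 1` and `u² + v² < η / 2`
  have hcorner : ∀ (p : ↥(S i)) (hp : p.1 ∈ F), ∃ C' : CornerSliceChart (S i) F u v ρ,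
      p.1 ∈ C'.Θ.source ∧ C'.Θ.source ⊆ O ∧ (∀ y ∈ C'.Θ.source, y ∈ V₁ ∧ χ y = 1) ∧
      ∃ G' : EuclideanSpace ℝ (Fin 4) → ℝ, ContDiffAt ℝ ∞ G' (cornerFold (C'.Θ p.1)) ∧
        fderiv ℝ G' (cornerFold (C'.Θ p.1)) ≠ 0 ∧
        ∀ q ∈ C'.Θ.source, q ∈ S i → G q = G' (cornerFold (C'.Θ q)) := by
    intro p hp
    set C := Φ.cornerDatum p hp with hCdef
    have hpC : p.1 ∈ C.Θ.source := Φ.corner_mem_source p hp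
    set qp : EuclideanSpace ℝ (Fin 4) := C.Θ p.1 with hqp
    obtain ⟨hu0, hv0⟩ := (hF p.1 (hFU hp)).1 hp
    have hqp0 : qp 0 = 0 := by rw [hqp, C.apply_zero _ hpC, hu0]
    have hqp1 : qp 1 = 0 := by rw [hqp, C.apply_one _ hpC, hv0]
    -- a ball around `qp` inside the target, pulled back into `V₁`
    set D : Set (EuclideanSpace ℝ (Fin 4)) := C.Θ.target ∩ C.Θ.symm ⁻¹' V₁ with hD
    have hDo : IsOpen D := C.Θ.continuousOn_symm.isOpen_inter_preimage C.Θ.open_target hV₁o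
    have hqD : qp ∈ D := ⟨C.Θ.map_source hpC, by
      show C.Θ.symm (C.Θ p.1) ∈ V₁; rw [C.Θ.left_inv hpC]; exact hFV₁ hp⟩
    obtain ⟨R₁, hR₁, hballD⟩ := Metric.isOpen_iff.1 hDo qp hqD
    set R : ℝ := min R₁ (Real.sqrt (η / 2)) with hR
    have hRpos : 0 < R := lt_min hR₁ (Real.sqrt_pos.2 (by linarith))
    have hballR : Metric.ball qp R ⊆ D := (Metric.ball_subset_ball (min_le_left _ _)).trans hballD
    -- the open set and the restricted chart
    set Ω : Set X := C.Θ.source ∩ C.Θ ⁻¹' Metric.ball qp R with hΩ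
    have hΩo : IsOpen Ω := C.Θ.continuousOn.isOpen_inter_preimage C.Θ.open_source Metric.isOpen_ball
    have hpΩ : p.1 ∈ Ω :=
      ⟨hpC, by show C.Θ p.1 ∈ Metric.ball qp R; exact Metric.mem_ball_self hRpos⟩
    -- points of `Ω`: in `V₁`, `u² + v² < η/2`, `χ = 1`
    have hΩfacts : ∀ y ∈ Ω, y ∈ V₁ ∧ u y ^ 2 + v y ^ 2 < η / 2 ∧ χ y = 1 := by
      rintro y ⟨hysrc, hyball⟩
      have hyball' : C.Θ y ∈ Metric.ball qp R := hyball
      have hyV₁ : y ∈ V₁ := by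
        have : C.Θ.symm (C.Θ y) ∈ V₁ := (hballR hyball').2
        rwa [C.Θ.left_inv hysrc] at this
      have hr : u y ^ 2 + v y ^ 2 < η / 2 := by
        have hdist : dist (C.Θ y) qp < Real.sqrt (η / 2) :=
          lt_of_lt_of_le (Metric.mem_ball.1 hyball') (min_le_right _ _)
        rw [dist_eq_norm, EuclideanSpace.norm_eq] at hdist
        have hsum : (C.Θ y - qp) 0 ^ 2 + (C.Θ y - qp) 1 ^ 2 ≤
            ∑ i', ‖(C.Θ y - qp) i'‖ ^ 2 := by
          simp only [Fin.sum_univ_four, Real.norm_eq_abs, sq_abs]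
          nlinarith [sq_nonneg ((C.Θ y - qp) 2), sq_nonneg ((C.Θ y - qp) 3)]
        have h0 : (C.Θ y - qp) 0 = u y := by
          rw [PiLp.sub_apply, hqp0, sub_zero, C.apply_zero _ hysrc]
        have h1 : (C.Θ y - qp) 1 = v y := by
          rw [PiLp.sub_apply, hqp1, sub_zero, C.apply_one _ hysrc]
        rw [h0, h1] at hsum
        have hlt : Real.sqrt (∑ i', ‖(C.Θ y - qp) i'‖ ^ 2) ^ 2 < Real.sqrt (η / 2) ^ 2 := by
          have hnn : 0 ≤ Real.sqrt (∑ i', ‖(C.Θ y - qp) i'‖ ^ 2) := Real.sqrt_nonneg _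
          nlinarith
        rw [Real.sq_sqrt (Finset.sum_nonneg fun _ _ => by positivity),
          Real.sq_sqrt (by linarith)] at hlt
        linarith
      refine ⟨hyV₁, hr, ?_⟩
      rw [hχV₁ y hyV₁]
      exact hχ₁one _ (by rw [div_le_iff₀ hη]; linarith)
    -- the restricted corner-slice chart (all fields inherited; `Ω` is `π`-stable)
    let C₁ : CornerSliceChart (S i) F u v ρ :=
      { Θ := C.Θ.restrOpen Ω hΩo
        contMDiffOn_toFun := C.contMDiffOn_toFun.mono (by
          rw [OpenPartialHomeomorph.restrOpen_source]; exact inter_subset_left)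
        contMDiffOn_symm := C.contMDiffOn_symm.mono (by intro z hz; exact hz.1)
        mem_iff := fun q hq => C.mem_iff q (by
          rw [OpenPartialHomeomorph.restrOpen_source] at hq; exact hq.1)
        apply_zero := fun q hq => C.apply_zero q (by
          rw [OpenPartialHomeomorph.restrOpen_source] at hq; exact hq.1)
        apply_one := fun q hq => C.apply_one q (by
          rw [OpenPartialHomeomorph.restrOpen_source] at hq; exact hq.1)
        mapsTo_π := by
          intro q hq
          rw [OpenPartialHomeomorph.restrOpen_source] at hq ⊢
          obtain ⟨hq1, hq2⟩ := hq
          have hπq : ρ q ∈ C.Θ.source := C.mapsTo_π hq1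
          refine ⟨hπq, hπq, ?_⟩
          show C.Θ (ρ q) ∈ Metric.ball qp R
          rw [C.apply_π q hq1, Metric.mem_ball, dist_eq_norm]
          have hq2' : C.Θ q ∈ Metric.ball qp R := hq2.2
          rw [Metric.mem_ball, dist_eq_norm] at hq2'
          exact (norm_stratumProj_sub_le hqp0 hqp1).trans_lt hq2'
        apply_π := fun q hq => C.apply_π q (by
          rw [OpenPartialHomeomorph.restrOpen_source] at hq; exact hq.1)
        mem_K_iff := fun q hq => C.mem_K_iff q (by
          rw [OpenPartialHomeomorph.restrOpen_source] at hq; exact hq.1) }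
    have hC₁src : C₁.Θ.source = Ω := by
      show (C.Θ.restrOpen Ω hΩo).source = Ω
      rw [OpenPartialHomeomorph.restrOpen_source, hΩ, ← inter_assoc, inter_self]
    have hC₁coe : ∀ q, C₁.Θ q = C.Θ q := fun q => rfl
    -- the corner form `G' x = 1 - x₀ · K (Θ⁻¹ (stratumProj x))`
    set κ : EuclideanSpace ℝ (Fin 4) → ℝ := fun x => K (C.Θ.symm (stratumProj x)) with hκ
    set G' : EuclideanSpace ℝ (Fin 4) → ℝ := fun x => 1 - x 0 * κ x with hG'
    have hxp : cornerFold qp = qp := by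
      ext i'; fin_cases i' <;> simp [cornerFold, hqp0, hqp1]
    have hsPqp : stratumProj qp = qp := stratumProj_eq_self hqp0 hqp1
    have hκs : ContDiffAt ℝ ∞ κ qp := by
      have h1 : ContMDiffOn 𝓘(ℝ, EuclideanSpace ℝ (Fin 4)) 𝓘(ℝ, ℝ) ∞ (K ∘ C.Θ.symm) C.Θ.target :=
        hKs.comp_contMDiffOn C.contMDiffOn_symm
      have h2 : ContDiffOn ℝ ∞ (K ∘ C.Θ.symm) C.Θ.target := contMDiffOn_iff_contDiffOn.mp h1
      have h3 : ContDiffAt ℝ ∞ (K ∘ C.Θ.symm) (stratumProj qp) := by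
        rw [hsPqp]; exact h2.contDiffAt (C.Θ.open_target.mem_nhds (C.Θ.map_source hpC))
      exact h3.comp qp contDiff_stratumProj.contDiffAt
    have hG's : ContDiffAt ℝ ∞ G' qp :=
      contDiffAt_const.sub ((contDiffAt_piLp_apply (p := 2) (i := (0 : Fin 4))).mul hκs)
    have hG'd : fderiv ℝ G' qp ≠ 0 := by
      have hκd := (hκs.differentiableAt (by simp)).hasFDerivAt
      have hprod : HasFDerivAt (fun x : EuclideanSpace ℝ (Fin 4) => x 0 * κ x)
          (qp 0 • fderiv ℝ κ qp + κ qp • EuclideanSpace.proj (𝕜 := ℝ) (0 : Fin 4)) qp :=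
        ((EuclideanSpace.proj (𝕜 := ℝ) (0 : Fin 4)).hasFDerivAt).mul hκd
      have hG'fd : HasFDerivAt G'
          (0 - (qp 0 • fderiv ℝ κ qp + κ qp • EuclideanSpace.proj (𝕜 := ℝ) (0 : Fin 4))) qp :=
        (hasFDerivAt_const (1:ℝ) qp).sub hprod
      rw [hG'fd.fderiv, hqp0, zero_smul, zero_add, zero_sub]
      intro hzero
      have := congrArg (fun L : EuclideanSpace ℝ (Fin 4) →L[ℝ] ℝ => L (EuclideanSpace.single 0 1))
        hzero
      simp only [neg_apply, smul_apply, smul_eq_mul, zero_apply] at this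
      have hκqp : κ qp = K p.1 := by
        show K (C.Θ.symm (stratumProj qp)) = K p.1
        rw [hsPqp, hqp, C.Θ.left_inv hpC]
      have hKp : 0 < K p.1 := hKpos _ (hFOK hp)
      have : κ qp = 0 := by
        have h' : κ qp *
            (EuclideanSpace.proj (𝕜 := ℝ) (0 : Fin 4) (EuclideanSpace.single 0 (1:ℝ))) = 0 := by
          linarith
        simpa using h'
      linarith [hκqp ▸ this]
    refine ⟨C₁, by rw [hC₁src]; exact hpΩ, ?_, fun y hy => ?_, G', ?_, ?_, fun q hq hqS => ?_⟩
    · rw [hC₁src]; exact fun y hy => (hΦO p hp) hy.1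
    · rw [hC₁src] at hy
      exact ⟨(hΩfacts y hy).1, (hΩfacts y hy).2.2⟩
    · rw [hC₁coe, ← hqp, hxp]; exact hG's
    · rw [hC₁coe, ← hqp, hxp]; exact hG'd
    · rw [hC₁src] at hq
      obtain ⟨hqV₁, -, hχ1⟩ := hΩfacts q hq
      obtain ⟨w, hw⟩ : q ∈ range e := by rw [hrange]; exact hqS
      have hf' := hformula w (by rw [hw]; exact hqV₁)
      rw [hw] at hf'
      rw [hf', hχ1, hC₁coe]
      -- `2 u v = (cornerFold (Θ q))₀` and `K (ρ q) = κ (cornerFold (Θ q))`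
      have hq1 : q ∈ C.Θ.source := hq.1
      have h0 : cornerFold (C.Θ q) 0 = 2 * u q * v q := by
        rw [cornerFold_apply_zero, C.apply_zero q hq1, C.apply_one q hq1]
      have hρq : K (ρ q) = κ (cornerFold (C.Θ q)) := by
        simp only [hκ, stratumProj_cornerFold]
        have := C.π_symm_eq (C.Θ.map_source hq1)
        rw [C.Θ.left_inv hq1] at this
        rw [this]
      simp only [hG', h0, hρq]; ring
  choose C' hpC' hC'O hC'V hC'G using hcorner
  -- the shrunk atlas
  let Φ' : CornerSliceAtlas (S i) F u v ρ :=
    { halfDatum := Φ.halfDatum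
      half_mem_source := Φ.half_mem_source
      half_not_mem := Φ.half_not_mem
      cornerDatum := C'
      corner_mem_source := hpC' }
  -- ### boundary and interior points of the shrunk structure, off `F`
  have hbdry_iff : ∀ (p : ↥(S i)) (hp : p.1 ∉ F),
      (letI := Φ'.chartedSpace; (𝓡∂ 4).IsInteriorPoint p) ↔ p.1 ∈ interior (S i) := by
    intro p hp
    rw [Φ'.isInteriorPoint_iff_of_not_mem p hp]
    exact (Φ.halfDatum p hp).apply_zero_pos_iff_mem_interior (Φ.half_mem_source p hp) p.2
  -- ### `G = 1` at the boundary points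
  have hb1 : letI := Φ'.chartedSpace; ∀ p : ↥(S i), (𝓡∂ 4).IsBoundaryPoint p → G p.1 = 1 := by
    letI := Φ'.chartedSpace
    intro p hpb
    obtain ⟨w, hw⟩ : p.1 ∈ range e := by rw [hrange]; exact p.2
    by_cases hpF : p.1 ∈ F
    · obtain ⟨hu0, hv0⟩ := (hF p.1 (hFU hpF)).1 hpF
      have := hformula w (by rw [hw]; exact hFV₁ hpF)
      rw [hw] at this
      rw [this, hu0, hv0]; ring
    · have hnot : p.1 ∉ interior (S i) := by
        intro hint
        have := (hbdry_iff p hpF).2 hint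
        exact (ModelWithCorners.isInteriorPoint_iff_not_isBoundaryPoint _ |>.1 this) hpb
      by_cases hpV₁ : p.1 ∈ V₁
      · have hf' := hformula w (by rw [hw]; exact hpV₁)
        rw [hw] at hf'
        rw [hf', mul_assoc 2 (u p.1) (v p.1), huvzero p.1 p.2 (hOU (hV₁V hpV₁).1) hnot]
        ring
      · have hχ0 : χ p.1 = 0 := hχout p.1 hpV₁
        have hV₀' : e w ∉ V₀ := fun hV => hpV₁ (hw ▸ hV.1)
        have hFf : Fext p.1 = f w := by rw [← hw]; exact hFextf w hV₀'
        have hf1 : f w = 1 := hfone w (by rw [hw]; exact hpF) (by rw [hw]; exact hnot)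
        simp only [hG, hχ0, sub_zero, zero_mul, one_mul, hFf, hf1, sub_self]
  -- ### `G < 1` at the interior points
  have hi1 : letI := Φ'.chartedSpace; ∀ p : ↥(S i), (𝓡∂ 4).IsInteriorPoint p → G p.1 < 1 := by
    letI := Φ'.chartedSpace
    intro p hpint
    have hpF : p.1 ∉ F := fun hpF =>
      (ModelWithCorners.isInteriorPoint_iff_not_isBoundaryPoint _ |>.1 hpint)
        (Φ'.isBoundaryPoint_of_mem p hpF)
    have hint : p.1 ∈ interior (S i) := (hbdry_iff p hpF).1 hpint
    obtain ⟨w, hw⟩ : p.1 ∈ range e := by rw [hrange]; exact p.2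
    by_cases hpV₁ : p.1 ∈ V₁
    · have hf' := hformula w (by rw [hw]; exact hpV₁)
      rw [hw] at hf'
      rw [hf']
      have hyU : p.1 ∈ U := hOU (hV₁V hpV₁).1
      obtain ⟨hu', hv'⟩ := huvpos w (by rw [hw]; exact hpF) (by rw [hw]; exact hyU)
        (by rw [hw]; exact hint)
      rw [hw] at hu' hv'
      have hK1 : 0 < K p.1 := hKpos _ (hV₁V hpV₁).2
      have hK2 : 0 < K (ρ p.1) := hKpos _ (hFOK (hρF _ (hV₁V hpV₁).1))
      have hχp := hχ01 p.1
      have hmix : 0 < (1 - χ p.1) * K p.1 + χ p.1 * K (ρ p.1) := by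
        rcases hχp.1.lt_or_eq with hlt | heq0
        · nlinarith
        · rw [← heq0]; simpa using hK1
      nlinarith [mul_pos (mul_pos hu' hv') hmix]
    · have hχ0 : χ p.1 = 0 := hχout p.1 hpV₁
      have hV₀' : e w ∉ V₀ := fun hV => hpV₁ (hw ▸ hV.1)
      have hFf : Fext p.1 = f w := by rw [← hw]; exact hFextf w hV₀'
      have hflt' : f w < 1 := hflt w (by rw [hw]; exact hpF) (by rw [hw]; exact hint)
      simp only [hG, hχ0, sub_zero, zero_mul, one_mul, hFf]
      linarith
  -- ### far from `F`: the cutoff vanishes identically, so `G ∘ e = f`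
  have hfarN : ∀ y, (y ∉ V₁ ∨ η < r2 y) → ∃ N : Set X, IsOpen N ∧ y ∈ N ∧
      ∀ z ∈ N, χ z = 0 ∧ z ∉ V₀ := by
    intro y hy
    -- on `{r2 > η}` and off `V₁` the cutoff vanishes and `V₀` is avoided
    have hbig : ∀ z, η < r2 z → χ z = 0 ∧ z ∉ V₀ := by
      intro z hz
      refine ⟨?_, fun hV => ?_⟩
      · by_cases hzV₁ : z ∈ V₁
        · rw [hχV₁ z hzV₁]
          exact hχ₁zero _ (by rw [le_div_iff₀ hη]; simp only [hr2] at hz; linarith)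
        · exact hχout z hzV₁
      · have : r2 z < η / 4 := hV.2
        linarith
    have hoff : ∀ z, z ∉ V₁ → χ z = 0 ∧ z ∉ V₀ := fun z hz => ⟨hχout z hz, fun hV => hz hV.1⟩
    rcases hy with hyV₁ | hyr
    · by_cases hycl : y ∈ closure V₁
      · have hr : η₀ < r2 y := hfront y hycl hyV₁
        refine ⟨r2 ⁻¹' Ioi η, isOpen_Ioi.preimage hr2s.continuous, ?_, fun z hz => hbig z hz⟩
        show η < r2 y; linarith
      · refine ⟨(closure V₁)ᶜ, isClosed_closure.isOpen_compl, hycl, fun z hz => hoff z ?_⟩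
        exact fun hzV₁ => hz (subset_closure hzV₁)
    · exact ⟨r2 ⁻¹' Ioi η, isOpen_Ioi.preimage hr2s.continuous, hyr, fun z hz => hbig z hz⟩
  have hfar : ∀ w, (e w ∉ V₁ ∨ η < r2 (e w)) → ∀ᶠ w' in 𝓝 w, G (e w') = f w' := by
    intro w hw
    obtain ⟨N, hNo, hwN, hN⟩ := hfarN (e w) hw
    have h1 : ∀ᶠ w' in 𝓝 w, e w' ∈ N :=
      he.continuous.continuousAt.preimage_mem_nhds (hNo.mem_nhds hwN)
    filter_upwards [h1] with w' hw'
    obtain ⟨hχ0, hV₀⟩ := hN _ hw'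
    simp only [hG, hχ0, sub_zero, one_mul, zero_mul, hFextf w' hV₀, sub_sub_cancel]
  -- ### near `F`: the formula in a corner-slice chart, and no critical points
  have hchartformula : ∀ (Cc : CornerSliceChart (S i) F u v ρ) (z : EuclideanSpace ℝ (Fin 4)),
      z ∈ Cc.Θ.target → 0 ≤ z 0 → 0 ≤ z 1 → Cc.Θ.symm z ∈ V₁ →
      G (Cc.Θ.symm z) = 1 - 2 * z 0 * z 1 *
        ((1 - Real.smoothTransition (2 - 2 * ((z 0 ^ 2 + z 1 ^ 2) / η))) * K (Cc.Θ.symm z) +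
          Real.smoothTransition (2 - 2 * ((z 0 ^ 2 + z 1 ^ 2) / η)) *
            K (Cc.Θ.symm (stratumProj z))) := by
    intro Cc z hz hz0 hz1 hzV₁
    set y := Cc.Θ.symm z with hy
    have hysrc : y ∈ Cc.Θ.source := Cc.Θ.map_target hz
    have hΘy : Cc.Θ y = z := Cc.Θ.right_inv hz
    have hyS : y ∈ S i := Cc.symm_mem hz ⟨hz0, hz1⟩
    obtain ⟨w, hw⟩ : y ∈ range e := by rw [hrange]; exact hyS
    have hf' := hformula w (by rw [hw]; exact hzV₁)
    rw [hw] at hf'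
    have huy : u y = z 0 := by rw [← Cc.apply_zero y hysrc, hΘy]
    have hvy : v y = z 1 := by rw [← Cc.apply_one y hysrc, hΘy]
    have hχy : χ y = Real.smoothTransition (2 - 2 * ((z 0 ^ 2 + z 1 ^ 2) / η)) := by
      rw [hχV₁ y hzV₁, huy, hvy]
    have hρy : K (ρ y) = K (Cc.Θ.symm (stratumProj z)) := by
      rw [hy, Cc.π_symm_eq hz]
    rw [hf', huy, hvy, hχy, hρy]
  have hnear : ∀ y ∈ S i, y ∉ F → y ∈ V₁ → r2 y ≤ η → ¬ IsMCriticalPt (𝓡 4) G y := by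
    intro y hyS hyF hyV₁ hyr
    have hyU : y ∈ U := hOU (hV₁V hyV₁).1
    obtain ⟨hu0, hv0⟩ := (hSi y hyU).1 hyS
    obtain ⟨Cc, qm, R, hysrc, hyball, hballT, hqm0, hqm1, hballOK, hbds⟩ :=
      hconst y ⟨hyS, subset_closure hyV₁⟩ (hyr.trans hηη₁)
    set q : EuclideanSpace ℝ (Fin 4) := Cc.Θ y with hq
    have hq0 : q 0 = u y := Cc.apply_zero y hysrc
    have hq1 : q 1 = v y := Cc.apply_one y hysrc
    have hqtgt : q ∈ Cc.Θ.target := Cc.Θ.map_source hysrc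
    have hsymmq : Cc.Θ.symm q = y := Cc.Θ.left_inv hysrc
    -- not both normal coordinates vanish
    have hne : ¬ (u y = 0 ∧ v y = 0) := fun h0 => hyF ((hF y hyU).2 h0)
    -- `G` read in the chart
    set Gh : EuclideanSpace ℝ (Fin 4) → ℝ := G ∘ Cc.Θ.symm with hGh
    have hGhs : ContDiffAt ℝ ∞ Gh q := by
      have h1 : ContMDiffOn 𝓘(ℝ, EuclideanSpace ℝ (Fin 4)) 𝓘(ℝ, ℝ) ∞ Gh Cc.Θ.target :=
        hGs.comp_contMDiffOn Cc.contMDiffOn_symm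
      exact (contMDiffOn_iff_contDiffOn.mp h1).contDiffAt (Cc.Θ.open_target.mem_nhds hqtgt)
    have hGhd : DifferentiableAt ℝ Gh q := hGhs.differentiableAt (by simp)
    -- the Morse-critical point condition read in the chart `Cc.Θ`
    have hmem2 : Cc.Θ ∈ IsManifold.maximalAtlas (𝓡 4) 2 X :=
      IsManifold.maximalAtlas_subset_of_le (M := X) (I := 𝓡 4) ENat.LEInfty.out
        Cc.Θ_mem_maximalAtlas
    have hcrit_iff : IsMCriticalPt (𝓡 4) G y ↔ fderiv ℝ Gh q = 0 := by
      rw [isMCriticalPt_iff_fderiv_comp_extend_symm_eq_zero (I := 𝓡 4)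
        ((hGs.contMDiffAt (x := y)).of_le ENat.LEInfty.out) hmem2 hysrc]
      have h1 : (G ∘ (Cc.Θ.extend (𝓡 4)).symm) = Gh := by ext z; simp [hGh]
      have h2 : Cc.Θ.extend (𝓡 4) y = q := by simp [hq]
      rw [h1, h2]
    rw [hcrit_iff]
    -- constants and bounds in the ball
    have hKd' : ∀ z ∈ Metric.ball qm R, DifferentiableAt ℝ (K ∘ Cc.Θ.symm) z :=
      fun z hz => (hbds z hz).1
    have hKC' : ∀ z ∈ Metric.ball qm R, ‖fderiv ℝ (K ∘ Cc.Θ.symm) z‖ ≤ C :=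
      fun z hz => (hbds z hz).2.1
    have hKm' : ∀ z ∈ Metric.ball qm R, m ≤ (K ∘ Cc.Θ.symm) z := fun z hz => (hbds z hz).2.2
    have hχd : Differentiable ℝ fun x : ℝ => Real.smoothTransition (2 - 2 * x) :=
      hχ₁s.differentiable (by simp)
    -- points of the line stay in the good region
    have hV₁near : ∀ᶠ z in 𝓝 q, z ∈ Metric.ball qm R ∧ Cc.Θ.symm z ∈ V₁ := by
      have h1 : ∀ᶠ z in 𝓝 q, z ∈ Metric.ball qm R := Metric.isOpen_ball.mem_nhds hyball
      have h2 : ∀ᶠ z in 𝓝 q, Cc.Θ.symm z ∈ V₁ := by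
        have hc : ContinuousAt Cc.Θ.symm q := Cc.Θ.continuousAt_symm hqtgt
        apply hc.preimage_mem_nhds
        rw [hsymmq]; exact hV₁o.mem_nhds hyV₁
      exact h1.and h2
    by_cases hv : 0 < v y
    · -- move in the `u`-direction
      set e0 : EuclideanSpace ℝ (Fin 4) := EuclideanSpace.single 0 (1:ℝ) with he0
      have ha : ∀ s : ℝ, (q + s • e0) 0 = q 0 + s := fun s => by simp [he0]
      have hb : ∀ s : ℝ, (q + s • e0) 1 = q 1 := fun s => by simp [he0]
      have hsP : ∀ s : ℝ, stratumProj (q + s • e0) = stratumProj q := fun s => by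
        ext i'; fin_cases i' <;> simp [stratumProj, he0]
      obtain ⟨g', hg'neg, hg'⟩ := hasDerivAt_interp_line_neg (Kh := K ∘ Cc.Θ.symm)
        (χ₁ := fun x : ℝ => Real.smoothTransition (2 - 2 * x)) (η := η) (qm := qm) (q := q)
        hKd' hKC' hKm' hC hχd hχ₁C hχ₁01 hCχ ⟨hqm0, hqm1⟩ hyball
        (by rw [hq0]; exact hu0) (by rw [hq1]; exact hv) hη (by rw [hq0, hq1]; exact hyr) hηsmall
      have hline : Tendsto (fun s : ℝ => q + s • e0) (𝓝 0) (𝓝 q) := by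
        have : Continuous fun s : ℝ => q + s • e0 := by fun_prop
        simpa using this.tendsto 0
      have heq : ∀ᶠ s in 𝓝[≥] (0:ℝ), Gh (q + s • e0) = 1 - 2 * (q 0 + s) * q 1 *
          ((1 - Real.smoothTransition (2 - 2 * (((q 0 + s) ^ 2 + q 1 ^ 2) / η))) *
              (K ∘ Cc.Θ.symm) (q + s • e0) +
            Real.smoothTransition (2 - 2 * (((q 0 + s) ^ 2 + q 1 ^ 2) / η)) *
              (K ∘ Cc.Θ.symm) (stratumProj q)) := by
        filter_upwards [(hline.eventually hV₁near).filter_mono nhdsWithin_le_nhds,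
          self_mem_nhdsWithin] with s hs hs0
        have hs0' : (0:ℝ) ≤ s := hs0
        have h := hchartformula Cc (q + s • e0) (hballT hs.1) (by rw [ha, hq0]; linarith)
          (by rw [hb, hq1]; exact hv0) hs.2
        simp only [hGh, comp_apply]
        rw [h, ha, hb, hsP]
      exact fderiv_ne_zero_of_eventuallyEq_line hGhd hg' hg'neg.ne heq
    · -- `v y = 0`, so `u y > 0`: move in the `v`-direction
      have hv0' : v y = 0 := le_antisymm (not_lt.1 hv) hv0
      have hu : 0 < u y := lt_of_le_of_ne hu0 fun h0 => hne ⟨h0.symm, hv0'⟩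
      set e1 : EuclideanSpace ℝ (Fin 4) := EuclideanSpace.single 1 (1:ℝ) with he1
      have ha : ∀ s : ℝ, (q + s • e1) 1 = q 1 + s := fun s => by simp [he1]
      have hb : ∀ s : ℝ, (q + s • e1) 0 = q 0 := fun s => by simp [he1]
      have hsP : ∀ s : ℝ, stratumProj (q + s • e1) = stratumProj q := fun s => by
        ext i'; fin_cases i' <;> simp [stratumProj, he1]
      obtain ⟨g', hg'neg, hg'⟩ := hasDerivAt_interp_line_neg' (Kh := K ∘ Cc.Θ.symm)
        (χ₁ := fun x : ℝ => Real.smoothTransition (2 - 2 * x)) (η := η) (qm := qm) (q := q)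
        hKd' hKC' hKm' hC hχd hχ₁C hχ₁01 hCχ ⟨hqm0, hqm1⟩ hyball
        (by rw [hq1]; exact hv0) (by rw [hq0]; exact hu) hη (by rw [hq0, hq1, add_comm]; exact hyr)
        hηsmall
      have hline : Tendsto (fun s : ℝ => q + s • e1) (𝓝 0) (𝓝 q) := by
        have : Continuous fun s : ℝ => q + s • e1 := by fun_prop
        simpa using this.tendsto 0
      have heq : ∀ᶠ s in 𝓝[≥] (0:ℝ), Gh (q + s • e1) = 1 - 2 * (q 1 + s) * q 0 *
          ((1 - Real.smoothTransition (2 - 2 * (((q 1 + s) ^ 2 + q 0 ^ 2) / η))) *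
              (K ∘ Cc.Θ.symm) (q + s • e1) +
            Real.smoothTransition (2 - 2 * (((q 1 + s) ^ 2 + q 0 ^ 2) / η)) *
              (K ∘ Cc.Θ.symm) (stratumProj q)) := by
        filter_upwards [(hline.eventually hV₁near).filter_mono nhdsWithin_le_nhds,
          self_mem_nhdsWithin] with s hs hs0
        have hs0' : (0:ℝ) ≤ s := hs0
        have h := hchartformula Cc (q + s • e1) (hballT hs.1) (by rw [hb, hq0]; exact hu0)
          (by rw [ha, hq1]; linarith) hs.2
        simp only [hGh, comp_apply]
        rw [h, ha, hb, hsP]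
        ring_nf
      exact fderiv_ne_zero_of_eventuallyEq_line hGhd hg' hg'neg.ne heq
  -- the dichotomy near / far, for points off `F`
  have hdich : ∀ y, (y ∈ V₁ ∧ r2 y ≤ η) ∨ (y ∉ V₁ ∨ η < r2 y) := by
    intro y
    by_cases h1 : y ∈ V₁
    · by_cases h2 : r2 y ≤ η
      · exact Or.inl ⟨h1, h2⟩
      · exact Or.inr (Or.inr (not_le.1 h2))
    · exact Or.inr (Or.inl h1)
  -- ### regular at the boundary points off `F`
  have hb2 : letI := Φ'.chartedSpace; ∀ p : ↥(S i), (𝓡∂ 4).IsBoundaryPoint p → p.1 ∉ F →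
      ¬ IsMCriticalPt (𝓡 4) G p.1 := by
    letI := Φ'.chartedSpace
    intro p hpb hpF
    have hnot : p.1 ∉ interior (S i) := fun hint =>
      (ModelWithCorners.isInteriorPoint_iff_not_isBoundaryPoint _ |>.1 ((hbdry_iff p hpF).2 hint))
        hpb
    obtain ⟨w, hw⟩ : p.1 ∈ range e := by rw [hrange]; exact p.2
    rcases hdich p.1 with ⟨hV₁, hr⟩ | hfarp
    · exact hnear p.1 p.2 hpF hV₁ hr
    · have hwb : (𝓡∂ 4).IsBoundaryPoint w := by
        rw [ModelWithCorners.isBoundaryPoint_iff_not_isInteriorPoint]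
        exact fun hint => hnot (hw ▸ (hWint w (by rw [hw]; exact hpF)).2 hint)
      have hreg : ¬ IsMCriticalPt (𝓡∂ 4) f w := (hf.2.1 w hwb).2
      have heq := hfar w (by rw [hw]; exact hfarp)
      rw [← hw]
      exact not_isMCriticalPt_of_comp_eventuallyEq
        ((himm w (by rw [hw]; exact hpF)).contMDiffAt.mdifferentiableAt (by simp))
        (hGs.contMDiffAt.mdifferentiableAt (by simp)) heq hreg
  -- ### nondegenerate at the interior critical points (all far from `F`)
  have hi2 : letI := Φ'.chartedSpace; ∀ p : ↥(S i), (𝓡∂ 4).IsInteriorPoint p →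
      IsMCriticalPt (𝓡 4) G p.1 → (mhessian (𝓡 4) G p.1).Nondegenerate := by
    letI := Φ'.chartedSpace
    intro p hpint hcrit
    have hpF : p.1 ∉ F := fun hpF =>
      (ModelWithCorners.isInteriorPoint_iff_not_isBoundaryPoint _ |>.1 hpint)
        (Φ'.isBoundaryPoint_of_mem p hpF)
    have hint : p.1 ∈ interior (S i) := (hbdry_iff p hpF).1 hpint
    obtain ⟨w, hw⟩ : p.1 ∈ range e := by rw [hrange]; exact p.2
    rcases hdich p.1 with ⟨hV₁, hr⟩ | hfarp
    · exact absurd hcrit (hnear p.1 p.2 hpF hV₁ hr)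
    · have hwint : (𝓡∂ 4).IsInteriorPoint w :=
        (hWint w (by rw [hw]; exact hpF)).1 (by rw [hw]; exact hint)
      have heq := hfar w (by rw [hw]; exact hfarp)
      obtain ⟨hiff, hdata⟩ := morseData_of_comp_eventuallyEq (himm w (by rw [hw]; exact hpF)) hwint
        hf.isMorse.contMDiff.contMDiffAt hGs.contMDiffAt heq
      rw [hw] at hiff hdata
      obtain ⟨hnd, -⟩ := hdata hcrit
      exact hnd.1 (hf.isMorse.nondegenerate (hiff.2 hcrit))
  -- ### counting: the interior critical points of `G` are the images of those of `f`
  have hcount' : letI := Φ'.chartedSpace; ∀ n : ℕ,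
      ((Subtype.val : ↥(S i) → X) '' ((𝓡∂ 4).interior ↥(S i)) ∩
        criticalSetOfIndex (𝓡 4) G n).ncard = c n := by
    letI := Φ'.chartedSpace
    intro n
    have hset : (Subtype.val : ↥(S i) → X) '' ((𝓡∂ 4).interior ↥(S i)) ∩
        criticalSetOfIndex (𝓡 4) G n =
        e '' criticalSetOfIndex (𝓡∂ 4) f n := by
      ext y
      constructor
      · rintro ⟨⟨p, hpint, rfl⟩, hcrit, hidx⟩
        have hpint' : (𝓡∂ 4).IsInteriorPoint p := hpint
        have hpF : p.1 ∉ F := fun hpF =>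
          (ModelWithCorners.isInteriorPoint_iff_not_isBoundaryPoint _ |>.1 hpint')
            (Φ'.isBoundaryPoint_of_mem p hpF)
        have hint : p.1 ∈ interior (S i) := (hbdry_iff p hpF).1 hpint'
        obtain ⟨w, hw⟩ : p.1 ∈ range e := by rw [hrange]; exact p.2
        rcases hdich p.1 with ⟨hV₁, hr⟩ | hfarp
        · exact absurd hcrit (hnear p.1 p.2 hpF hV₁ hr)
        · have hwint : (𝓡∂ 4).IsInteriorPoint w :=
            (hWint w (by rw [hw]; exact hpF)).1 (by rw [hw]; exact hint)
          have heq := hfar w (by rw [hw]; exact hfarp)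
          obtain ⟨hiff, hdata⟩ := morseData_of_comp_eventuallyEq (himm w (by rw [hw]; exact hpF))
            hwint hf.isMorse.contMDiff.contMDiffAt hGs.contMDiffAt heq
          rw [hw] at hiff hdata
          obtain ⟨-, hidx'⟩ := hdata hcrit
          refine ⟨w, ⟨hiff.2 hcrit, ?_⟩, hw⟩
          rw [hidx', hidx]
      · rintro ⟨w, ⟨hcritw, hidxw⟩, rfl⟩
        -- a critical point of `f` is interior and far from `F`
        have hwF : e w ∉ F := by
          intro hwF
          have hyS : e w ∈ S i := by rw [← hrange]; exact mem_range_self w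
          obtain ⟨hu0', -⟩ := (hF _ (hFU hwF)).1 hwF
          obtain ⟨j', hj', hyj'⟩ := hface _ (hFU hwF) hyS (Or.inl hu0')
          obtain ⟨w', hw'b, hw'e⟩ := hbd j' hj' ⟨hyS, hyj'⟩
          rw [he.injective hw'e] at hw'b
          exact (hf.2.1 w hw'b).2 hcritw
        have hwint : (𝓡∂ 4).IsInteriorPoint w := by
          rcases (𝓡∂ 4).isInteriorPoint_or_isBoundaryPoint w with hwi | hwb
          · exact hwi
          · exact absurd hcritw (hf.2.1 w hwb).2
        have hint : e w ∈ interior (S i) := (hWint w hwF).2 hwint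
        have hfarp : e w ∉ V₁ ∨ η < r2 (e w) := by
          by_cases hV₁ : e w ∈ V₁
          · exact Or.inr (lt_of_le_of_lt hηη₂ (hη₂crit w hcritw (subset_closure hV₁)))
          · exact Or.inl hV₁
        have heq := hfar w hfarp
        obtain ⟨hiff, hdata⟩ := morseData_of_comp_eventuallyEq (himm w hwF) hwint
          hf.isMorse.contMDiff.contMDiffAt hGs.contMDiffAt heq
        have hcritG : IsMCriticalPt (𝓡 4) G (e w) := hiff.1 hcritw
        obtain ⟨-, hidx'⟩ := hdata hcritG
        have hyS : e w ∈ S i := by rw [← hrange]; exact mem_range_self w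
        refine ⟨⟨⟨e w, hyS⟩, ?_, rfl⟩, hcritG, by rw [← hidx', hidxw]⟩
        exact (hbdry_iff ⟨e w, hyS⟩ hwF).2 hint
    rw [hset, Set.ncard_image_of_injective _ he.injective, hcount n]
  -- ### conclusion
  refine ⟨Φ', fun p hp => hC'O p hp, ?_⟩
  exact Φ'.hasHandleDecomposition_of_comp_val (F := G) (fun q _ _ => hGs.contMDiffAt)
    (fun p hp => hC'G p hp) hb1 hb2 hi1 hi2 hcount'


/-- **The re-structured sector carries the handle decomposition of the old one** (normal form
with an ambient Morse function).  For a trisection with corners `S` of a closed `4`-manifold,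
a sector `S i` and a second sector `S j`: the global normal coordinates, retraction and
corner-slice atlas of `IsGKTrisection.exists_cornerSliceAtlas` (corner charts possibly shrunk),
and, for the straightened structure `CornerSliceAtlas.chartedSpace` on `↥(S i)`, a handle
decomposition with the handle counts `handleCount 1 (k i)` of clause (ii)
(`hasHandleDecomposition_of_normalForm` fed with the sector manifold of clause (ii)).
[cite: GayKirby2016, Def. 1; Milnor1963, §§2–3] -/
theorem IsGKTrisection.exists_cornerSliceAtlas_hasHandleDecomposition (h : IsGKTrisection X g k S)
    {i j : Fin 3} (hji : j ≠ i) :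
    ∃ (u v : X → ℝ) (U O : Set X) (ρ : X → X) (l : Fin 3), l ≠ i ∧ l ≠ j ∧ IsOpen U ∧
      IsOpen O ∧ (⋂ m, S m) ⊆ O ∧ O ⊆ U ∧
      ContMDiff (𝓡 4) 𝓘(ℝ, ℝ) ∞ u ∧ ContMDiff (𝓡 4) 𝓘(ℝ, ℝ) ∞ v ∧
      ContMDiff (𝓡 4) (𝓡 4) ∞ ρ ∧
      (∀ y ∈ U, y ∈ S i ↔ 0 ≤ u y ∧ 0 ≤ v y) ∧
      (∀ y ∈ U, y ∈ S j ↔ u y ≤ 0 ∧ u y ≤ v y) ∧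
      (∀ y ∈ U, y ∈ S l ↔ v y ≤ 0 ∧ v y ≤ u y) ∧
      (∀ y ∈ U, y ∈ (⋂ m, S m) ↔ u y = 0 ∧ v y = 0) ∧
      (∀ y ∈ O, ρ y ∈ ⋂ m, S m) ∧ (∀ y ∈ U, u y = 0 → v y = 0 → ρ y = y) ∧ MapsTo ρ O O ∧
      ∃ Φ : CornerSliceAtlas (S i) (⋂ m, S m) u v ρ,
        (∀ (p : ↥(S i)) (hp : p.1 ∈ ⋂ m, S m), (Φ.cornerDatum p hp).Θ.source ⊆ O) ∧
        (letI := Φ.chartedSpace; HasHandleDecomposition 3 ↥(S i) (handleCount 1 (k i))) := by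
  obtain ⟨u, v, U, O, ρ, l, hli, hlj, hUo, hOo, hFO, hOU, hu, hv, hρs, hSi, hSj, hSl, hF, hρF,
    hρfix, hρO, Φ, hΦO⟩ := h.exists_cornerSliceAtlas hji
  obtain ⟨W, _, _, e, hM, hWc, -, ⟨f, hf, hcount⟩, he, hrange, himm, hcor, hbd⟩ := h.2.1 i
  haveI := hM
  haveI := hWc
  have hface : ∀ y ∈ U, y ∈ S i → (u y = 0 ∨ v y = 0) → ∃ j', j' ≠ i ∧ y ∈ S j' := by
    intro y hy hyS huv
    obtain ⟨hu0, hv0⟩ := (hSi y hy).1 hyS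
    rcases huv with h0 | h0
    · exact ⟨j, hji, (hSj y hy).2 ⟨le_of_eq h0, by rw [h0]; exact hv0⟩⟩
    · exact ⟨l, hli, (hSl y hy).2 ⟨le_of_eq h0, by rw [h0]; exact hu0⟩⟩
  obtain ⟨Φ', hΦ'O, hHD⟩ := hasHandleDecomposition_of_normalForm he hrange himm hcor hbd hf hcount
    hu hv hUo hSi hF hface h.isCompact_iInter hOo hFO hOU hρs hρF Φ hΦO
  exact ⟨u, v, U, O, ρ, l, hli, hlj, hUo, hOo, hFO, hOU, hu, hv, hρs, hSi, hSj, hSl, hF, hρF, hρfix,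
    hρO, Φ', hΦ'O, hHD⟩

end Assembly

end Literature.Topology.FourManifolds
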